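import Summits.ResolutionOfSingularities.ResolutionOfSingularities.Theorems.UniformComplexityCampaignW82SeparableTightnessCore
import Summits.ResolutionOfSingularities.ResolutionOfSingularities.Theorems.UniformComplexityCampaignW82HypersurfaceBaseChange
import Summits.ResolutionOfSingularities.ResolutionOfSingularities.Theorems.UniversalCellsCampaignW82FrobeniusTwistProofs
import Mathlib.Algebra.CharP.Lemmas
import HarnessLib

/-!
# [OURS · L1 W8.2] Separable tightness, TWISTED: no smooth proper model of `y^q = (x^{p^{m+1}} − c)^{p^b}`
# (`c ∉ K^p`), and the core over a variety containing it

Cell `res-hironaka` (run/shared/lean/pub/res-hironaka/), LADDER-RESOLUTION rung L (RESCUE), slot W8.2, door 2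
(`UniformComplexity`, host item `PrimeModelTransfer` stmt-ResolutionOfSingularities-8933); prover res-L1-s82-pv-2
(gen 7). THESES-FREE module (imports the gen-7 `…SeparableTightnessCore` (p555296), the gen-4
`…HypersurfaceBaseChange` (`TwistNormal.pullbackHypIso`), the door-1 file `…FrobeniusTwistProofs` (res-L1-s82-pv-1:
`exists_smoothModel_baseChange`), Mathlib, `HarnessLib`).

WHY. The separable tightness (`not_familyResolutionSep`, headline file) says a resolving base extension must adjoin
`t^{1/p}` generically. The gen-3 rung «no bounded Frobenius-twist exponent» (p510058,
`no_smooth_model_frobeniusTwist_of_le`, stated over `K = M(t)` only) suggests more: for the TWISTED pencils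
`y^q = x^{p^{e+1}} − t` the resolving base must adjoin `t^{1/p^{e+1}}` — no bound on the inseparable EXPONENT of
the base extension across families of curves over one base `k[t]`. This file supplies the field-level input over
an ARBITRARY field `K` of characteristic `p`:

* `no_smooth_model_twistCurve_pow` — `c ∈ K` with `X^p − c` irreducible, `q ≠ p` prime, `m b : ℕ`: the curve
  `y^q = (x^{p^{m+1}} − c)^{p^b}` (`TwistExponent.twistCurve K (p^(m+1)) c q (p^b)`) has NO proper birational model
  smooth over `K`. (Base change along `Frob^m : K → K` — smooth proper birational models base-change,
  `exists_smoothModel_baseChange` — turns it into `y^q = (x^p − c)^{p^{m+b}}`, `TwistNormal.pullbackHypIso` +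
  the identity `twistPoly_frob_pow`, which has none: gen 3 `no_smooth_model_twistCurve`.)
* `false_of_smooth_proper_isoOver_pow`, `false_of_isRegular_pullback_proper_isoOver_pow` — the Core theorems of
  p555296 with Kollár's curve replaced by `y^q = (x^{p^{m+1}} − c)^{p^b}`.

HONEST FRAMING. OURS negative-side bookkeeping; NOT a statement of H. Hironaka's 2017 manuscript ([Hironaka2017]);
nothing here is attributed to its author. AI work, weaker than expert review.

## References (vocabulary and locators only)
* J. Kollár, *Lectures on Resolution of Singularities* (2007), 1.19. [Kollar2007]
* The Stacks Project, Tags 056S, 02VL. [StacksProject]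
-/

noncomputable section

set_option linter.dupNamespace false -- mandated namespace of this single-conjunct summit

open Polynomial
open _root_.CategoryTheory _root_.CategoryTheory.Limits _root_.AlgebraicGeometry _root_.TopologicalSpace
open Literature.AlgebraicGeometry.Resolution

namespace Summit.ResolutionOfSingularities.ResolutionOfSingularities.Theorems.CampaignW82.SeparableTightness

/-! ## §1 Polynomial identities and `Spec` of equal hypersurface quotients -/

section Identities

variable (K : Type) [Field K] (p : ℕ) (c : K) (q : ℕ)

/-- Under a ring map `θ`, `twistPoly` maps to `twistPoly` with `c ↦ θ c`. [folklore] -/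
theorem map_twistPoly {L : Type} [Field L] (θ : K →+* L) (P N : ℕ) :
    MvPolynomial.map θ (TwistExponent.twistPoly K P c q N) = TwistExponent.twistPoly L P (θ c) q N := by
  simp [TwistExponent.twistPoly, MvPolynomial.map_X, MvPolynomial.map_C]

/-- **Frobenius identity**: in characteristic `p`,
`X₀^q − (X₁^{p^{m+1}} − c^{p^m})^{p^b} = X₀^q − (X₁^p − c)^{p^{m+b}}`. [folklore] -/
theorem twistPoly_frob_pow [Fact p.Prime] [CharP K p] (m b : ℕ) :
    TwistExponent.twistPoly K (p ^ (m + 1)) (c ^ p ^ m) q (p ^ b) =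
      TwistExponent.twistPoly K p c q (p ^ (m + b)) := by
  simp only [TwistExponent.twistPoly]
  have h : (MvPolynomial.X 1 ^ p ^ (m + 1) - MvPolynomial.C (c ^ p ^ m) : MvPolynomial (Fin 2) K) =
      (MvPolynomial.X 1 ^ p - MvPolynomial.C c) ^ p ^ m := by
    rw [sub_pow_char_pow, ← pow_mul, ← pow_succ', map_pow]
  rw [h, ← pow_mul, ← pow_add]

variable {K} in
/-- Equal polynomials give isomorphic hypersurface quotients (`Ideal.quotEquivOfEq`, in `Spec.map` form).
[folklore] -/
def hypSpecIsoOfEq {σ : Type} {f g : MvPolynomial σ K} (h : f = g) :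
    TwistNormal.hypSpec K f ≅ TwistNormal.hypSpec K g :=
  Scheme.Spec.mapIso
    ((Ideal.quotEquivOfEq (by rw [h]) : TwistNormal.HypRing K g ≃+* TwistNormal.HypRing K f).toCommRingCatIso).op

variable {K} in
/-- `hypSpecIsoOfEq` lies over `Spec K`. [folklore] -/
theorem hypSpecIsoOfEq_hom_comp {σ : Type} {f g : MvPolynomial σ K} (h : f = g) :
    (hypSpecIsoOfEq h).hom ≫ TwistNormal.hypTo K g = TwistNormal.hypTo K f := by
  change Spec.map _ ≫ Spec.map _ = Spec.map _
  rw [← Spec.map_comp]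
  congr 1

end Identities

/-! ## §2 No smooth proper birational model of `y^q = (x^{p^{m+1}} − c)^{p^b}` -/

section NoSmoothModel

variable (K : Type) [Field K] (p : ℕ) (c : K) (q : ℕ)

/-- **No proper birational model of `y^q = (x^{p^{m+1}} − c)^{p^b}` is smooth over `K`** (`X^p − c` irreducible
over `K`, `q ≠ p` prime, any `m b`). Proof: transport the model along the base change by the `m`-th iterate of
Frobenius `θ = Frob^m : K → K` (`exists_smoothModel_baseChange` with `σ = id`, `τ = θ`): the base-changed curve is
`y^q = (x^{p^{m+1}} − c^{p^m})^{p^b} = (x^p − c)^{p^{m+b}}` (`TwistNormal.pullbackHypIso`, `map_twistPoly`,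
`twistPoly_frob_pow`), i.e. `C_{p^{m+b}}` of gen 3, which has no smooth proper birational model
(`TwistExponent.no_smooth_model_twistCurve`). For `K = M(t)`, `c = t` this is gen 3's
`no_smooth_model_frobeniusTwist_of_le`; here `K` is arbitrary. [cite: Kollar2007, 1.19] -/
theorem no_smooth_model_twistCurve_pow [hp : Fact p.Prime] [CharP K p] [hq : Fact q.Prime] (hqp : q ≠ p)
    (hc : Irreducible (X ^ p - C c : K[X])) (m b : ℕ) (Y : Scheme.{0})
    (π : Y ⟶ TwistExponent.twistCurve K (p ^ (m + 1)) c q (p ^ b)) [IsProper π] (hbir : IsBirational π)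
    [hsm : Smooth (π ≫ TwistExponent.twistCurveTo K (p ^ (m + 1)) c q (p ^ b))] : False := by
  -- the structure morphism, as a hypersurface
  let f₀ : TwistNormal.hypSpec K (TwistExponent.twistPoly K (p ^ (m + 1)) c q (p ^ b)) ⟶ Spec (.of K) :=
    TwistNormal.hypTo K (TwistExponent.twistPoly K (p ^ (m + 1)) c q (p ^ b))
  haveI : LocallyOfFiniteType f₀ := TwistNormal.locallyOfFiniteType_hypTo K _
  -- Step 1: the model as a model of `X₀ ×_{K, id} K`
  let g₁ : Spec (.of K) ⟶ Spec (.of K) := Spec.map (CommRingCat.ofHom (RingHom.id K))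
  have hg₁ : g₁ = 𝟙 _ := by
    change Spec.map (CommRingCat.ofHom (RingHom.id K)) = _
    rw [CommRingCat.ofHom_id]; exact Spec.map_id _
  haveI : IsIso g₁ := by rw [hg₁]; infer_instance
  haveI : IsIso (pullback.fst f₀ g₁) := inferInstance
  let ρ : Y ⟶ pullback f₀ g₁ := π ≫ inv (pullback.fst f₀ g₁)
  have hbirρ : IsBirational ρ := hbir.comp_iso (inv (pullback.fst f₀ g₁))
  have hρsnd : ρ ≫ pullback.snd f₀ g₁ = (π ≫ f₀) ≫ inv g₁ := by
    change (π ≫ inv (pullback.fst f₀ g₁)) ≫ pullback.snd f₀ g₁ = (π ≫ f₀) ≫ inv g₁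
    rw [Category.assoc, Category.assoc]
    congr 1
    rw [IsIso.inv_comp_eq, ← Category.assoc, pullback.condition, Category.assoc, IsIso.hom_inv_id,
      Category.comp_id]
  haveI : Smooth (ρ ≫ pullback.snd f₀ g₁) := by rw [hρsnd]; infer_instance
  -- Step 2: base change along `θ = Frob^m`
  let θ : K →+* K := iterateFrobenius K p m
  obtain ⟨Y', ρ', hP', hB', hS'⟩ :=
    exists_smoothModel_baseChange f₀ (RingHom.id K) θ θ (θ.comp_id) Y ρ hbirρ
  haveI := hP'
  haveI := hS'
  -- Step 3: identify the base change with `C_{p^{m+b}} : y^q = (x^p − c)^{p^{m+b}}`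
  let ε₁ := TwistNormal.pullbackHypIso K (TwistExponent.twistPoly K (p ^ (m + 1)) c q (p ^ b)) K θ
  have hid : MvPolynomial.map θ (TwistExponent.twistPoly K (p ^ (m + 1)) c q (p ^ b)) =
      TwistExponent.twistPoly K p c q (p ^ (m + b)) := by
    rw [map_twistPoly, show θ c = c ^ p ^ m from iterateFrobenius_def .., twistPoly_frob_pow]
  let ε₂ := hypSpecIsoOfEq (K := K) hid
  let π' : Y' ⟶ TwistExponent.twistCurve K p c q (p ^ (m + b)) := (ρ' ≫ ε₁.hom) ≫ ε₂.hom
  have hbir' : IsBirational π' := (hB'.comp_iso ε₁.hom).comp_iso ε₂.hom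
  haveI : IsProper π' := inferInstance
  haveI : Smooth (π' ≫ TwistExponent.twistCurveTo K p c q (p ^ (m + b))) := by
    have : π' ≫ TwistExponent.twistCurveTo K p c q (p ^ (m + b)) =
        ρ' ≫ pullback.snd f₀ (Spec.map (CommRingCat.ofHom θ)) := by
      simp only [π', Category.assoc]
      rw [show TwistExponent.twistCurveTo K p c q (p ^ (m + b)) =
          TwistNormal.hypTo K (TwistExponent.twistPoly K p c q (p ^ (m + b))) from rfl,
        hypSpecIsoOfEq_hom_comp, TwistNormal.pullbackHypIso_hom_comp]
    rw [this]; exact hS'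
  -- Step 4: gen 3
  exact TwistExponent.no_smooth_model_twistCurve K p c q hqp hc (pow_pos hp.out.pos (m + b))
    ((Nat.coprime_primes hq.out hp.out).mpr hqp |>.pow_right (m + b)) Y' π' hbir'

end NoSmoothModel

/-! ## §3 The core over a variety containing `y^q = (x^{p^{m+1}} − c)^{p^b}` as an open subscheme -/

section Core

variable (K : Type) [Field K] (p : ℕ) (c : K) (q : ℕ)

/-- **Twisted core.** `K` of characteristic `p`, `X^p − c` irreducible over `K`, `q ≠ p` prime, `m b : ℕ`; `X'` an
irreducible `K`-scheme containing `C = {y^q = (x^{p^{m+1}} − c)^{p^b}}` as an open subscheme over `K`. Then no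
`π : Y' → X'` is proper, an isomorphism over a non-empty open, with `Y'` SMOOTH over `K` (resolution piece
restricted over `C`, then `no_smooth_model_twistCurve_pow`). [cite: Kollar2007, 1.19] -/
theorem false_of_smooth_proper_isoOver_pow [Fact p.Prime] [CharP K p] [Fact q.Prime] (hqp : q ≠ p)
    (hc : Irreducible (X ^ p - C c : K[X])) (m b : ℕ)
    {X' Y' : Scheme.{0}} (g : X' ⟶ Spec (.of K)) [IrreducibleSpace X']
    (i : TwistExponent.twistCurve K (p ^ (m + 1)) c q (p ^ b) ⟶ X') [IsOpenImmersion i]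
    (hi : i ≫ g = TwistExponent.twistCurveTo K (p ^ (m + 1)) c q (p ^ b))
    (π : Y' ⟶ X') [IsProper π] (W : X'.Opens) (hW : (W : Set X').Nonempty) (hiso : IsIso (π ∣_ W))
    [hsm : Smooth (π ≫ g)] : False := by
  have hreg : Scheme.IsRegular Y' := fun y => isRegularLocalRing_stalk_of_smooth_of_field (π ≫ g) y
  haveI : IsLocallyNoetherian Y' := LocallyOfFiniteType.isLocallyNoetherian (π ≫ g)
  have hWd : Dense (W : Set X') := W.2.dense hW
  obtain ⟨V, hres⟩ := exists_isResolution_ι_comp π hreg W hWd hiso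
  haveI := hres.isProper
  let U : X'.Opens := i.opensRange
  have hbirU : IsBirational ((V.ι ≫ π) ∣_ U) := hres.isBirational.morphismRestrict U
  let e : TwistExponent.twistCurve K (p ^ (m + 1)) c q (p ^ b) ≅ (U : Scheme.{0}) := i.isoOpensRange
  let ρ' : ↑((V.ι ≫ π) ⁻¹ᵁ U) ⟶ TwistExponent.twistCurve K (p ^ (m + 1)) c q (p ^ b) :=
    ((V.ι ≫ π) ∣_ U) ≫ e.inv
  have hbir' : IsBirational ρ' := hbirU.comp_iso e.inv
  have hfac : ρ' ≫ TwistExponent.twistCurveTo K (p ^ (m + 1)) c q (p ^ b) =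
      ((V.ι ≫ π) ⁻¹ᵁ U).ι ≫ V.ι ≫ π ≫ g := by
    rw [← hi]
    change ((V.ι ≫ π) ∣_ U) ≫ e.inv ≫ i ≫ g = _
    rw [show e.inv ≫ i ≫ g = U.ι ≫ g by rw [← Category.assoc, i.isoOpensRange_inv_comp]]
    rw [← Category.assoc, morphismRestrict_ι, Category.assoc, Category.assoc]
  haveI : Smooth (ρ' ≫ TwistExponent.twistCurveTo K (p ^ (m + 1)) c q (p ^ b)) := by
    rw [hfac]
    haveI : Smooth (V.ι ≫ π ≫ g) := inferInstance
    infer_instance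
  exact no_smooth_model_twistCurve_pow K p c q hqp hc m b _ ρ' hbir'

/-- **Twisted core, regular geometric fibre form**: as `false_of_isRegular_pullback_proper_isoOver` (p555296) with
Kollár's curve replaced by `y^q = (x^{p^{m+1}} − c)^{p^b}`: if the base change of `Y'` to a perfect `Ω ⊇ K` is
regular then `Y'` is smooth over `K` (`smooth_of_isRegular_pullback`) and `false_of_smooth_proper_isoOver_pow`
applies. [cite: Kollar2007, 1.19] -/
theorem false_of_isRegular_pullback_proper_isoOver_pow [Fact p.Prime] [CharP K p] [Fact q.Prime] (hqp : q ≠ p)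
    (hc : Irreducible (X ^ p - C c : K[X])) (m b : ℕ) {Ω : Type} [Field Ω] [PerfectField Ω] (φ : K →+* Ω)
    {X' Y' : Scheme.{0}} (g : X' ⟶ Spec (.of K)) [IrreducibleSpace X']
    (i : TwistExponent.twistCurve K (p ^ (m + 1)) c q (p ^ b) ⟶ X') [IsOpenImmersion i]
    (hi : i ≫ g = TwistExponent.twistCurveTo K (p ^ (m + 1)) c q (p ^ b))
    (π : Y' ⟶ X') [IsProper π] (W : X'.Opens) (hW : (W : Set X').Nonempty) (hiso : IsIso (π ∣_ W))
    [LocallyOfFiniteType (π ≫ g)]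
    (hreg : Scheme.IsRegular (pullback (π ≫ g) (Spec.map (CommRingCat.ofHom φ)))) : False := by
  haveI : Smooth (π ≫ g) := smooth_of_isRegular_pullback φ (π ≫ g) hreg
  exact false_of_smooth_proper_isoOver_pow K p c q hqp hc m b g i hi π W hW hiso

end Core

end Summit.ResolutionOfSingularities.ResolutionOfSingularities.Theorems.CampaignW82.SeparableTightness

end
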